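import Literature.IUT.LogVolume.ExplicitEstimatesTheorem53
import Literature.Barriers.ABC.IUTDisputedClaimProofs
import HarnessLib

/-!
# [ExpEst] Corollary 5.9 (generalized Fermat equation `r x^l + s y^m + t z^n = 0`) from the DISPUTED Theorem B — the implication, PROVED

S. Mochizuki, I. Fesenko, Y. Hoshi, A. Minamide, W. Porowski, *Explicit estimates in inter-universal
Teichmüller theory*, Kodai Math. J. **45** (2022) 175–236 (= [ExpEst]), §5, **Corollary 5.9** (pp. 233–234)
with its proof (p. 234, Claim 5.9A) (render
`plan/repair/lit/renders/MFHMP-ExplicitEstimates-Kodai2022-book-anonnd-eeiutp`, pdf p. 59 l.38 – p. 60 l.47;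
pdf page = journal page − 174). The STATEMENT was typed by this seat's gen 0 as the candidate predicate
`Literature.IUT.LogVolume.ExpEst.Cor59` (`ExplicitEstimatesTheorem53.lean`, claim-tagged, never asserted). This
file PROVES `IUTDisputedClaim → Cor59 r s t l m n` for all `r s t l m n` (`cor59_of_IUTDisputedClaim`), where
`IUTDisputedClaim` (`Literature/Barriers/ABC/IUTDisputedClaim.lean`, `@[conjecture]`) is the tree's record of
[ExpEst] Theorem B = Theorem 5.4, whose proof depends on [IUTchIII] Cor. 3.12 and is DISPUTED
(Scholze–Stix). HONEST FRAMING: nothing here asserts Theorem B or Cor. 5.9; the file makes kernel-precise that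
Cor. 5.9 is downstream of the single disputed inequality (typed ≠ proved ≠ endorsed; no side is taken).

Kernel route = the printed proof (p. 234): **Claim 5.9A** "`r x^l`, `s y^m`, and `t z^n` are coprime" (`claim59A`:
a common prime `q` divides exactly two of `x, y, z`, hence `q^k` divides the third coefficient, so
`log₂‖rst‖ ≥ k` — contradiction; here `k = min{l, m, n}`); then Theorem B with `(a, b, c) = (r x^l, s y^m, t z^n)`,
`ε = 1`, the lower bound `‖rst‖·‖xyz‖^k ≤ ‖abc‖` and the radical bound `rad(abc) ≤ rad(rst)·‖xyz‖`
(Mathlib `radical_mul_dvd`, `radical_pow`, `radical_dvd_self`); the `max` is split into the radical branch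
(absurd by `k > 10 + 5·log₂ rad(rst)`, `‖xyz‖ ≥ 2`) and the exponential branch (absurd by `k > 2.453·10^30`,
`1/log 2 < 1.4427`). All constants are the printed ones.

Deliberately NOT here: any unconditional statement about the generalized Fermat equation (Darmon–Granville,
Beal-type results are other sources); Cor. 5.8 (`ExplicitEstimatesFLTLargePrimes.lean`). No definition and no
named fact is introduced.

## References
* [MochizukiEtAl2022] Kodai Math. J. 45 (2022), Cor. 5.9 (pp. 233–234), Theorem B / Thm. 5.4 [claim key,
  status disputed, D-0012].
* [ScholzeStix2018] P. Scholze, J. Stix, *Why abc is still a conjecture* (dissent on [IUTchIII] Cor. 3.12).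
-/

namespace Literature.IUT.LogVolume

namespace ExpEst

open Real UniqueFactorizationMonoid Literature.Barriers.ABC

/-- `rad(a) ≤ |a|` for a nonzero integer. [folklore] -/
private theorem radical_le_abs {a : ℤ} (ha : a ≠ 0) : radical a ≤ |a| :=
  Int.le_of_dvd (abs_pos.mpr ha) ((dvd_abs _ _).mpr radical_dvd_self)

/-- `rad(ab) ≤ rad(a)·rad(b)` in `ℤ`. [folklore] -/
private theorem radical_mul_le (a b : ℤ) : radical (a * b) ≤ radical a * radical b :=
  Int.le_of_dvd (mul_pos (Int.radical_pos _) (Int.radical_pos _)) radical_mul_dvd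

/-- `log₂ X < k` with `X > 0` gives `X < 2^k`. [folklore] -/
private theorem lt_two_pow_of_logb_lt {X : ℝ} (hX : 0 < X) {k : ℕ} (h : Real.logb 2 X < k) : X < (2 : ℝ) ^ k := by
  rw [← Real.log_div_log, div_lt_iff₀ (Real.log_pos one_lt_two)] at h
  have : Real.log X < Real.log ((2 : ℝ) ^ k) := by rw [Real.log_pow]; exact h
  exact (Real.log_lt_log_iff hX (by positivity)).mp this

/-- **Claim 5.9A** (p. 234): under the hypotheses of Cor. 5.9, `r x^l`, `s y^m` (and `t z^n`) are coprime.
[cite: MochizukiEtAl2022, Cor 5.9 proof p. 234] -/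
private theorem claim59A {r s t x y z : ℤ} {l m n k : ℕ} (hr : r ≠ 0) (hs : s ≠ 0) (ht : t ≠ 0)
    (hrs : Int.gcd r s = 1) (hst : Int.gcd s t = 1) (hrt : Int.gcd r t = 1)
    (hkl : k ≤ l) (hkm : k ≤ m) (hkn : k ≤ n)
    (hk2 : Real.logb 2 |((r * s * t : ℤ) : ℝ)| < k)
    (hg : Int.gcd (Int.gcd x y) z = 1) (heq : r * x ^ l + s * y ^ m + t * z ^ n = 0) :
    Int.gcd (r * x ^ l) (s * y ^ m) = 1 := by
  by_contra hne
  obtain ⟨q, hq, hqg⟩ := Nat.exists_prime_and_dvd hne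
  have hQ : Prime (q : ℤ) := Nat.prime_iff_prime_int.mp hq
  have h1 : (q : ℤ) ∣ r * x ^ l := (Int.natCast_dvd_natCast.mpr hqg).trans (Int.gcd_dvd_left ..)
  have h2 : (q : ℤ) ∣ s * y ^ m := (Int.natCast_dvd_natCast.mpr hqg).trans (Int.gcd_dvd_right ..)
  have h3 : (q : ℤ) ∣ t * z ^ n := by
    have e : t * z ^ n = -(r * x ^ l + s * y ^ m) := by linarith
    rw [e]; exact (dvd_add h1 h2).neg_right
  have crs := Int.isCoprime_iff_gcd_eq_one.mpr hrs
  have cst := Int.isCoprime_iff_gcd_eq_one.mpr hst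
  have crt := Int.isCoprime_iff_gcd_eq_one.mpr hrt
  have cg := Int.isCoprime_iff_gcd_eq_one.mpr hg
  -- no coefficient is divisible by `q^k`, since `|rst| < 2^k ≤ q^k`
  have hrst0 : (0 : ℝ) < |((r * s * t : ℤ) : ℝ)| := by
    have : r * s * t ≠ 0 := mul_ne_zero (mul_ne_zero hr hs) ht
    exact abs_pos.mpr (by exact_mod_cast this)
  have hlt : |((r * s * t : ℤ) : ℝ)| < (2 : ℝ) ^ k := lt_two_pow_of_logb_lt hrst0 hk2
  have hbig : ∀ u v : ℤ, v ≠ 0 → r * s * t = u * v → ¬ (q : ℤ) ^ k ∣ u := by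
    intro u v hv huv hdvd
    have hu : u ≠ 0 := by
      rintro rfl; rw [zero_mul] at huv; exact mul_ne_zero (mul_ne_zero hr hs) ht huv
    have hle : (q : ℤ) ^ k ≤ |u| := Int.le_of_dvd (abs_pos.mpr hu) ((dvd_abs _ _).mpr hdvd)
    have hq2 : (2 : ℤ) ^ k ≤ (q : ℤ) ^ k := pow_le_pow_left₀ (by norm_num) (by exact_mod_cast hq.two_le) k
    have hv1 : 1 ≤ |v| := Int.one_le_abs hv
    have huv' : |r * s * t| = |u| * |v| := by rw [huv, abs_mul]
    have : (2 : ℤ) ^ k ≤ |r * s * t| := by nlinarith [abs_nonneg u]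
    have : ((2 : ℤ) ^ k : ℝ) ≤ |((r * s * t : ℤ) : ℝ)| := by
      rw [← Int.cast_abs]; exact_mod_cast this
    push_cast at this hlt
    linarith
  have hA : (q : ℤ) ∣ r ∨ (q : ℤ) ∣ x := by
    rcases hQ.dvd_or_dvd h1 with h | h
    · exact Or.inl h
    · exact Or.inr (hQ.dvd_of_dvd_pow h)
  have hB : (q : ℤ) ∣ s ∨ (q : ℤ) ∣ y := by
    rcases hQ.dvd_or_dvd h2 with h | h
    · exact Or.inl h
    · exact Or.inr (hQ.dvd_of_dvd_pow h)
  have hC : (q : ℤ) ∣ t ∨ (q : ℤ) ∣ z := by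
    rcases hQ.dvd_or_dvd h3 with h | h
    · exact Or.inl h
    · exact Or.inr (hQ.dvd_of_dvd_pow h)
  have nxyz : ¬ ((q : ℤ) ∣ x ∧ (q : ℤ) ∣ y ∧ (q : ℤ) ∣ z) := fun ⟨a, b, c⟩ =>
    hQ.not_unit (cg.isUnit_of_dvd' (Int.natCast_dvd_natCast.mpr (Int.dvd_gcd a b)) c)
  -- `q ∣ w` gives `q^k ∣ (coefficient)·w^e` for `e ≥ k`
  have hpow : ∀ (c w : ℤ) (e : ℕ), k ≤ e → (q : ℤ) ∣ w → (q : ℤ) ^ k ∣ c * w ^ e :=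
    fun c w e he hw => ((pow_dvd_pow_of_dvd hw k).trans (pow_dvd_pow w he)).mul_left c
  -- `q ∤ w` makes `q^k` coprime to `w^e`
  have hcop : ∀ (w : ℤ) (e : ℕ), ¬ (q : ℤ) ∣ w → IsCoprime ((q : ℤ) ^ k) (w ^ e) :=
    fun w e hw => ((hQ.irreducible.coprime_iff_not_dvd).mpr hw).pow
  rcases hA with hqr | hqx <;> rcases hB with hqs | hqy <;> rcases hC with hqt | hqz
  · exact hQ.not_unit (crs.isUnit_of_dvd' hqr hqs)
  · exact hQ.not_unit (crs.isUnit_of_dvd' hqr hqs)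
  · exact hQ.not_unit (crt.isUnit_of_dvd' hqr hqt)
  · -- `q ∣ r, y, z`, so `q ∤ x`, and `q^k ∣ r`
    have hqx : ¬ (q : ℤ) ∣ x := fun h => nxyz ⟨h, hqy, hqz⟩
    have : (q : ℤ) ^ k ∣ r * x ^ l := by
      have e : r * x ^ l = -(s * y ^ m + t * z ^ n) := by linarith
      rw [e]; exact (dvd_add (hpow s y m hkm hqy) (hpow t z n hkn hqz)).neg_right
    exact hbig r (s * t) (mul_ne_zero hs ht) (by ring) ((hcop x l hqx).dvd_of_dvd_mul_right this)
  · exact hQ.not_unit (cst.isUnit_of_dvd' hqs hqt)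
  · have hqy : ¬ (q : ℤ) ∣ y := fun h => nxyz ⟨hqx, h, hqz⟩
    have : (q : ℤ) ^ k ∣ s * y ^ m := by
      have e : s * y ^ m = -(r * x ^ l + t * z ^ n) := by linarith
      rw [e]; exact (dvd_add (hpow r x l hkl hqx) (hpow t z n hkn hqz)).neg_right
    exact hbig s (r * t) (mul_ne_zero hr ht) (by ring) ((hcop y m hqy).dvd_of_dvd_mul_right this)
  · have hqz : ¬ (q : ℤ) ∣ z := fun h => nxyz ⟨hqx, hqy, h⟩
    have : (q : ℤ) ^ k ∣ t * z ^ n := by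
      have e : t * z ^ n = -(r * x ^ l + s * y ^ m) := by linarith
      rw [e]; exact (dvd_add (hpow r x l hkl hqx) (hpow s y m hkm hqy)).neg_right
    exact hbig t (r * s) (mul_ne_zero hr hs) (by ring) ((hcop z n hqz).dvd_of_dvd_mul_right this)
  · exact nxyz ⟨hqx, hqy, hqz⟩

/-- **[ExpEst] Corollary 5.9 (Application to a generalized version of "Fermat's Last Theorem"), conditional form**
(pp. 233–234): "Let `r, s, t` be nonzero integers every two of which are coprime. Write
`S := {(X, Y, Z) ∈ ℤ³ | ‖XYZ‖_ℂ ≥ 2}`. Let `l, m, n` be positive integers such that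
`min{l, m, n} > max{2.453·10^30, log₂‖rst‖_ℂ, 10 + 5·log₂(rad(rst))}`. Then there does not exist any triple
`(x, y, z) ∈ S` of coprime [i.e., the set of prime numbers which divide `x`, `y`, and `z` is empty] integers that
satisfies the equation `r x^l + s y^m + t z^n = 0`." PROVED in the kernel FROM the disputed Theorem B taken BY
NAME (`H : IUTDisputedClaim`, `@[conjecture]`, [claim: MochizukiEtAl2022, status: disputed]): the conclusion
is exactly the tree's candidate predicate `ExpEst.Cor59 r s t l m n` (`ExplicitEstimatesTheorem53.lean`), which
thereby stops being an independent claim-tagged hypothesis — it is downstream of `IUTDisputedClaim`. Route as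
printed (p. 234): Claim 5.9A (`claim59A`); Theorem B at `(r x^l, s y^m, t z^n)`, `ε = 1`:
`‖rst‖·‖xyz‖^k ≤ ‖r x^l s y^m t z^n‖ ≤ 2^4·max{exp(1.7·10^30), rad(rst x^l y^m z^n)^6}` with
`rad(rst x^l y^m z^n) ≤ rad(rst)·‖xyz‖` (print: `= rad(rst·xyz)`); the radical branch contradicts
`k > 10 + 5·log₂ rad(rst)` and `‖xyz‖ ≥ 2` (print: "`> 2^4 (rad(rst))^6 ‖xyz‖^6 ≥ 2^4 rad(rstxyz)^6`"); the
exponential branch gives `2^k ≤ 2^4 exp(1.7·10^30)`, "hence `k ≤ 2.453·10^30` — a contradiction" (kernel: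
`k·log 2 ≤ 4·log 2 + 1.7·10^30` with `log 2 > 0.6931471803`). NOTHING here asserts `IUTDisputedClaim`.
[claim: MochizukiEtAl2022, status: disputed] -/
theorem cor59_of_IUTDisputedClaim (H : IUTDisputedClaim) (r s t : ℤ) (l m n : ℕ) : Cor59 r s t l m n := by
  intro hr hs ht hrs hst hrt hl hm hn hk
  rintro ⟨x, y, z, hxyz, hg, heq⟩
  set k : ℕ := min l (min m n) with hkdef
  have hkl : k ≤ l := min_le_left _ _
  have hkm : k ≤ m := (min_le_right _ _).trans (min_le_left _ _)
  have hkn : k ≤ n := (min_le_right _ _).trans (min_le_right _ _)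
  have hk1 : (2.453e30 : ℝ) < k := lt_of_le_of_lt (le_max_left _ _) hk
  have hk2 : Real.logb 2 |((r * s * t : ℤ) : ℝ)| < k :=
    lt_of_le_of_lt ((le_max_left _ _).trans (le_max_right _ _)) hk
  have hk3 : 10 + 5 * Real.logb 2 ((radical (r * s * t) : ℤ) : ℝ) < k :=
    lt_of_le_of_lt ((le_max_right _ _).trans (le_max_right _ _)) hk
  -- `x, y, z ≠ 0`
  have hx : x ≠ 0 := by rintro rfl; simp at hxyz
  have hy : y ≠ 0 := by rintro rfl; simp at hxyz
  have hz : z ≠ 0 := by rintro rfl; simp at hxyz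
  -- Claim 5.9A and Theorem B at `(r x^l, s y^m, t z^n)`, `ε = 1`
  have hgab := claim59A hr hs ht hrs hst hrt hkl hkm hkn hk2 hg heq
  have ha : r * x ^ l ≠ 0 := mul_ne_zero hr (pow_ne_zero l hx)
  have hb : s * y ^ m ≠ 0 := mul_ne_zero hs (pow_ne_zero m hy)
  have hc : t * z ^ n ≠ 0 := mul_ne_zero ht (pow_ne_zero n hz)
  have key := H (r * x ^ l) (s * y ^ m) (t * z ^ n) ha hb hc hgab heq 1 one_pos le_rfl
  rw [Real.one_rpow, mul_one] at key
  have h6 : (3 * (1 + 1) : ℝ) = ((6 : ℕ) : ℝ) := by norm_num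
  rw [h6, Real.rpow_natCast] at key
  -- notation: `ρ = rad(rst) ≥ 1`, `P = |xyz| ≥ 2`
  set ρ : ℤ := radical (r * s * t) with hρ
  have hρ1 : 1 ≤ ρ := Int.radical_pos _
  have hP2 : (2 : ℤ) ≤ |x * y * z| := hxyz
  -- the radical of `abc` is at most `ρ · |xyz|`
  have hrad : (radical (r * x ^ l * (s * y ^ m) * (t * z ^ n)) : ℤ) ≤ ρ * |x * y * z| := by
    have e : r * x ^ l * (s * y ^ m) * (t * z ^ n) = (r * s * t) * (x ^ l * (y ^ m * z ^ n)) := by ring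
    rw [e]
    refine (radical_mul_le _ _).trans ?_
    refine mul_le_mul_of_nonneg_left ?_ (Int.radical_pos _).le
    calc radical (x ^ l * (y ^ m * z ^ n)) ≤ radical (x ^ l) * radical (y ^ m * z ^ n) := radical_mul_le _ _
      _ ≤ radical (x ^ l) * (radical (y ^ m) * radical (z ^ n)) :=
          mul_le_mul_of_nonneg_left (radical_mul_le _ _) (Int.radical_pos _).le
      _ = radical x * (radical y * radical z) := by
          rw [radical_pow x (by omega), radical_pow y (by omega), radical_pow z (by omega)]
      _ ≤ |x| * (|y| * |z|) := by
          have := radical_le_abs hx; have := radical_le_abs hy; have := radical_le_abs hz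
          have := Int.radical_pos x; have := Int.radical_pos y; have := Int.radical_pos z
          gcongr
      _ = |x * y * z| := by rw [abs_mul, abs_mul]; ring
  -- lower bound `|abc| ≥ ρ · |xyz|^k`
  have hlow : ρ * |x * y * z| ^ k ≤ |r * x ^ l * (s * y ^ m) * (t * z ^ n)| := by
    have hρle : ρ ≤ |r * s * t| := radical_le_abs (mul_ne_zero (mul_ne_zero hr hs) ht)
    have hxk : |x| ^ k ≤ |x| ^ l := pow_le_pow_right₀ (Int.one_le_abs hx) hkl
    have hyk : |y| ^ k ≤ |y| ^ m := pow_le_pow_right₀ (Int.one_le_abs hy) hkm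
    have hzk : |z| ^ k ≤ |z| ^ n := pow_le_pow_right₀ (Int.one_le_abs hz) hkn
    have e1 : |r * x ^ l * (s * y ^ m) * (t * z ^ n)| = |r * s * t| * (|x| ^ l * |y| ^ m * |z| ^ n) := by
      simp only [abs_mul, abs_pow]; ring
    have e2 : |x * y * z| ^ k = |x| ^ k * |y| ^ k * |z| ^ k := by rw [abs_mul, abs_mul, mul_pow, mul_pow]
    rw [e1, e2]
    have h0 : (0 : ℤ) ≤ ρ := by omega
    exact mul_le_mul hρle (mul_le_mul (mul_le_mul hxk hyk (by positivity) (by positivity)) hzk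
      (by positivity) (by positivity)) (by positivity) (abs_nonneg _)
  -- pass to `ℝ`
  set P : ℤ := |x * y * z| with hP
  set A : ℤ := r * x ^ l * (s * y ^ m) * (t * z ^ n) with hAdef
  have hPr : (2 : ℝ) ≤ (P : ℝ) := by exact_mod_cast hP2
  have hρr : (1 : ℝ) ≤ (ρ : ℝ) := by exact_mod_cast hρ1
  have hlowr : (ρ : ℝ) * (P : ℝ) ^ k ≤ (|A| : ℤ) := by exact_mod_cast hlow
  have hkeyr : ((|A| : ℤ) : ℝ) ≤ 2 ^ 4 * max (Real.exp 1.7e30) (((radical A : ℤ) : ℝ) ^ 6) := by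
    have e : ((|A| : ℤ) : ℝ) = |((r * x ^ l : ℤ) : ℝ) * ((s * y ^ m : ℤ) : ℝ) * ((t * z ^ n : ℤ) : ℝ)| := by
      rw [hAdef]; push_cast; rfl
    rw [e]; exact key
  have hradr : (((radical A : ℤ)) : ℝ) ≤ (ρ : ℝ) * P := by exact_mod_cast hrad
  have hrad0 : (0 : ℝ) ≤ ((radical A : ℤ) : ℝ) := by exact_mod_cast (Int.radical_pos A).le
  have hl2 : (0.6931471803 : ℝ) < Real.log 2 := Real.log_two_gt_d9
  have hl2' : Real.log 2 < 0.6931471808 := Real.log_two_lt_d9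
  rcases le_total (((radical A : ℤ) : ℝ) ^ 6) (Real.exp 1.7e30) with hRE | hER
  · -- exponential branch: `2^k ≤ ρ P^k ≤ 16 e^{1.7·10^30}`, so `k ≤ 4 + 1.7·10^30/log 2 < 2.453·10^30`
    rw [max_eq_left hRE] at hkeyr
    have h2k : (2 : ℝ) ^ k ≤ (P : ℝ) ^ k := pow_le_pow_left₀ (by norm_num) hPr k
    have hPk : (0 : ℝ) < (P : ℝ) ^ k := by positivity
    have h1 : (2 : ℝ) ^ k ≤ 2 ^ 4 * Real.exp 1.7e30 := by nlinarith
    have h2 := Real.log_le_log (by positivity) h1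
    rw [Real.log_pow, Real.log_mul (by norm_num) (Real.exp_pos _).ne', Real.log_pow, Real.log_exp] at h2
    have h3 : (2.453e30 : ℝ) * 0.6931471803 ≤ (k : ℝ) * Real.log 2 :=
      mul_le_mul hk1.le hl2.le (by norm_num) (by positivity)
    push_cast at h2
    linarith
  · -- radical branch: `ρ P^k ≤ 16 (ρP)^6` contradicts `k > 10 + 5 log₂ ρ`, `P ≥ 2`
    rw [max_eq_right hER] at hkeyr
    have hR6 : ((radical A : ℤ) : ℝ) ^ 6 ≤ ((ρ : ℝ) * P) ^ 6 := pow_le_pow_left₀ hrad0 hradr 6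
    have hmain : (ρ : ℝ) * (P : ℝ) ^ k ≤ 16 * ((ρ : ℝ) ^ 6 * (P : ℝ) ^ 6) := by
      have := hlowr.trans (hkeyr.trans (by nlinarith : (2 : ℝ) ^ 4 * ((radical A : ℤ) : ℝ) ^ 6 ≤ 16 * ((ρ : ℝ) * P) ^ 6))
      rw [mul_pow] at this; exact this
    -- `k ≥ 11` and `ρ^5 < 2^{k−10}`
    have hlogρ : 0 ≤ Real.logb 2 (ρ : ℝ) := Real.logb_nonneg one_lt_two hρr
    have hk11 : 11 ≤ k := by
      have : (10 : ℝ) < k := by linarith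
      exact_mod_cast this
    have hρ5 : (ρ : ℝ) ^ 5 < (2 : ℝ) ^ (k - 10) := by
      have hρ0 : (0 : ℝ) < ρ := by linarith
      rw [← Real.log_lt_log_iff (by positivity) (by positivity), Real.log_pow, Real.log_pow]
      have hsub : ((k - 10 : ℕ) : ℝ) = (k : ℝ) - 10 := by
        rw [Nat.cast_sub (by omega)]; norm_num
      rw [hsub]
      rw [← Real.log_div_log] at hk3
      have hlog2pos : 0 < Real.log 2 := by linarith
      have h5 : 5 * (Real.log (ρ : ℝ) / Real.log 2) < (k : ℝ) - 10 := by linarith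
      have e5 : (5 : ℝ) * Real.log (ρ : ℝ) = (5 * (Real.log (ρ : ℝ) / Real.log 2)) * Real.log 2 := by
        field_simp
      push_cast
      rw [e5]
      exact mul_lt_mul_of_pos_right h5 hlog2pos
    -- `P^k ≥ 2^{k−6} P^6 = 16·2^{k−10}·P^6 > 16 ρ^5 P^6`
    have hP0 : (0 : ℝ) < P := by linarith
    have hPk : (P : ℝ) ^ k = (P : ℝ) ^ (k - 10) * (P : ℝ) ^ 4 * (P : ℝ) ^ 6 := by
      rw [← pow_add, ← pow_add]; congr 1; omega
    have hP4 : (16 : ℝ) ≤ (P : ℝ) ^ 4 := by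
      calc (16 : ℝ) = 2 ^ 4 := by norm_num
        _ ≤ (P : ℝ) ^ 4 := pow_le_pow_left₀ (by norm_num) hPr 4
    have hPk10 : (2 : ℝ) ^ (k - 10) ≤ (P : ℝ) ^ (k - 10) := pow_le_pow_left₀ (by norm_num) hPr _
    have hP6 : (0 : ℝ) < (P : ℝ) ^ 6 := by positivity
    have hρ0 : (0 : ℝ) < ρ := by linarith
    -- divide the main inequality by `ρ > 0`
    have hmain' : (P : ℝ) ^ k ≤ 16 * (ρ : ℝ) ^ 5 * (P : ℝ) ^ 6 := by
      have : (ρ : ℝ) * (P : ℝ) ^ k ≤ (ρ : ℝ) * (16 * (ρ : ℝ) ^ 5 * (P : ℝ) ^ 6) := by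
        calc (ρ : ℝ) * (P : ℝ) ^ k ≤ 16 * ((ρ : ℝ) ^ 6 * (P : ℝ) ^ 6) := hmain
          _ = (ρ : ℝ) * (16 * (ρ : ℝ) ^ 5 * (P : ℝ) ^ 6) := by ring
      exact le_of_mul_le_mul_left this hρ0
    rw [hPk] at hmain'
    have h210 : (0 : ℝ) < (2 : ℝ) ^ (k - 10) := by positivity
    nlinarith [mul_le_mul hPk10 hP4 (by norm_num) (by positivity), mul_lt_mul_of_pos_right hρ5 hP6]

end ExpEst

end Literature.IUT.LogVolume
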